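import Summits.QuantumFields.BalabanUV.Beta.D1BFx.SliceTransferBordered

/-!
# `BalabanUV.Beta.D1BFx.SliceTransferGhost` — road «BF-x» for binder row D1, leaf K-R1 AT MODEL LEVEL (part 4):
# UNPACKING THE BORDERED GHOST — (i) the bordered functional `secondVar (kkt X Q)` depends on `X` only through its compression `ZᵀXZ` to
# `ker Q`; (ii) for `X = M·M` (Schur): `secondVar (kkt (MM) Q) = 2·secondVar M + secondVar (Q (MM)⁻¹ Qᵀ)` — the SCALAR TOWER twice plus the
# coarse Gram, i.e. the loop-weight table of `HOME/b2b-balaban-beta-d1-p2/K-R1-SPEC.md` §2 (v1.1) as a theorem at model level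

HONEST DEPENDENCY (page 1, mandatory): continuum YM on T⁴ ⇐ BetaPertH ∧ nine spine estimates (0/9 proved); BetaPertH ⇐ (D1) ∧
(D4) ∧ CAP+tail; G-an2-4 gates asym, D1 and NE2/3/4.  HONEST FRAMING (cell contract, verbatim): «discharging `BetaPertH` makes
Bałaban's UV stability UNCONDITIONAL — a real constructive-QFT result; it is NOT the continuum limit and NOT the Clay problem.»
THIS MODULE DISCHARGES NOTHING of the wall: [folklore] finite-dimensional algebra/calculus over the tree's `Beta.Composition` (`det_kkt'`, the
signed Schur evaluation of a bordered determinant) and parts 1–3.  No `def`, no `Prop` mirror, no cited fact, 0 sorry; 0 wall binders; NOT D1,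
NOT BetaPertH, NOT continuum, NOT Clay.

ABSOLUTE RULE (cell charter, verbatim): «No internally-minted statement may enter as a cited fact. Every hypothesis is either
kernel-proved in this package or a verbatim quotation of a PUBLISHED theorem with page reference. The manuscript(s) under audit are NOT
citable for their own disputed steps — they are the thing under adjudication; programme-internal (2001/route/tribunal) claims are never
citable.»

WHY (K-R1-SPEC §2–§3 (M4)).  Part 3 (`secondVar_sliceTransfer_basisFree`) leaves the Faddeev–Popov ghost of the slice transfer as the
`Q′`-bordered functional of the scalar form `X_F = D*_U (D_U R_U D*_U) D_U` — on the road equal ON `ker Q′` to `Δ_U²` and to `(Δ_U + Q′*aQ′)²`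
(B9 (3.21)–(3.26), CONTEXT).  §1 says the bordered functional sees only the compression to `ker Q′`, so any of the three may be used; §3 then
unpacks the square: with `M := Δ_U + Q′*aQ′ = G′⁻¹` (the typed scalar tower, T2 `Ggh` at `U = 1`) and `S := Q′ G′² Q′*` (the coarse Gram of
B9 (3.25), J5's object), `h[kkt (MM) Q′] = 2·h[M] + h[S]` in `hessKer` units — scalar tower with weight 2, coarse Gram with weight 1 (both entering
the slice transfer with an overall MINUS sign: typed = reduced + axial ghost − this).

CONTENT (all [folklore]):
* §1 `secondVar_kkt_congr_of_compression` — `Q Z = 0`, `det(QQᵀ) ≠ 0`, `det(ZᵀZ) ≠ 0`, `ZᵀXZ = ZᵀX′Z` near `0`, `det kkt X Q ≠ 0` at `0` ⟹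
  `secondVar (kkt X Q) = secondVar (kkt X′ Q)` (jets of `X`, `X′` arbitrary `C²` data).
* §2 `logAbsDet_kkt_mul_self` — `det M ≠ 0`, `det(Q(MM)⁻¹Qᵀ) ≠ 0` ⟹ `log|det kkt (MM) Q| = 2·log|det M| + log|det (Q (MM)⁻¹ Qᵀ)|`;
  `absDet_kkt_mul_self` — `|det kkt (MM) Q| = |det M|²·|det (Q (MM)⁻¹ Qᵀ)|`.
* §3 `secondVar_kkt_mul_self` — along `C²` curves with `X = M·M` and `S = Q X⁻¹ Qᵀ` near `0` (jets of `X`, `Q`, `M`, `S` as abstract `C²` data):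
  `secondVar (kkt X Q) = 2·secondVar M + secondVar S` at `0`.
* §4 `secondVar_polarise` — the algebraic polarisation identity turning the curve statements of parts 2–4 into statements about the MIXED
  functional `tr(A₀⁻¹A₂″) − tr(A₀⁻¹A₁A₀⁻¹A₁′)` (= 2 × the typed `hessKer`'s `½·tadpole − ½·bubble` in the bond pair `(μ0; νz)`).
* §5 `kkt_fromRows_zero_eq_conj`, `oneLoop_eq_compressed` — the jets of part 2's `M` live on the `(ν ⊕ μ)` blocks, so only the `(ν ⊕ μ)`
  compression `EᵀM⁻¹E` of the bordered inverse (= the typed packing `KInv = [[Γ, wHᵀ],[wH, wΦ]]`, no gauge block) enters the functional.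
* §6 `secondVar_fixedWeight` — part 2 with the CONSTANT weight `P := τ`: the ghosts cancel and the typed functional equals that of
  `kkt (K + τᵀτ) Q` with the SAME jets (the no-ghost, fixed-weight representation; exact, but not the covariant one of an3's table).
-/

noncomputable section

namespace Summit.QuantumFields.BalabanUV.Beta.D1BFx.SliceTransferGhost

open Matrix Filter Finset
open scoped Topology
open Literature.MathematicalPhysics.QuantumFieldTheory.Balaban1983to89.Beta.Composition (kkt det_kkt')
open Literature.Analysis.Calculus (eventually_det_ne_zero)
open Summit.QuantumFields.BalabanUV.Beta.D1BFx.LogDetSecondVariation (secondVar secondVar_comb_eq_zero secondVar_eq_of_logAbsDet_eq)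
open Summit.QuantumFields.BalabanUV.Beta.D1BFx.SliceTransferModel (hasDerivAt_kkt)
open Summit.QuantumFields.BalabanUV.Beta.D1BFx.SliceTransferBordered (det_kkt_mul_det_gram)

variable {σ κ : Type*} [Fintype σ] [Fintype κ] [DecidableEq σ] [DecidableEq κ]

/-! ## §1 The bordered functional sees only the compression to `ker Q` -/

/-- [folklore] **COMPRESSION INVARIANCE.**  Two scalar forms with the same compression `ZᵀXZ = ZᵀX′Z` to `ker Q` (any basis `Z`: `Q Z = 0`,
`det(ZᵀZ) ≠ 0`; `det(QQᵀ) ≠ 0`) have the same bordered determinant (`SliceTransferBordered.det_kkt_mul_det_gram`), hence — along `C²` curves,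
with all these relations holding near `0` and `det kkt X Q ≠ 0` at `0` — the same bordered one-loop functional, whatever their jets. -/
theorem secondVar_kkt_congr_of_compression
    {X X₁ X' X'₁ : ℝ → (σ ⊕ κ) → (σ ⊕ κ) → ℝ} {X₂ X'₂ : Matrix (σ ⊕ κ) (σ ⊕ κ) ℝ}
    {Q Q₁ : ℝ → κ → (σ ⊕ κ) → ℝ} {Q₂ : Matrix κ (σ ⊕ κ) ℝ} {Z : ℝ → (σ ⊕ κ) → σ → ℝ}
    (hX : ∀ᶠ u in 𝓝 (0 : ℝ), HasDerivAt X (X₁ u) u) (hX₁ : HasDerivAt X₁ (Matrix.of.symm X₂) 0)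
    (hX' : ∀ᶠ u in 𝓝 (0 : ℝ), HasDerivAt X' (X'₁ u) u) (hX'₁ : HasDerivAt X'₁ (Matrix.of.symm X'₂) 0)
    (hQ : ∀ᶠ u in 𝓝 (0 : ℝ), HasDerivAt Q (Q₁ u) u) (hQ₁ : HasDerivAt Q₁ (Matrix.of.symm Q₂) 0)
    (hQZ : ∀ᶠ u in 𝓝 (0 : ℝ), Matrix.of (Q u) * Matrix.of (Z u) = 0)
    (hZZ : ∀ᶠ u in 𝓝 (0 : ℝ), ((Matrix.of (Z u))ᵀ * Matrix.of (Z u)).det ≠ 0)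
    (hQQ : ∀ᶠ u in 𝓝 (0 : ℝ), (Matrix.of (Q u) * (Matrix.of (Q u))ᵀ).det ≠ 0)
    (hcomp : ∀ᶠ u in 𝓝 (0 : ℝ), (Matrix.of (Z u))ᵀ * Matrix.of (X u) * Matrix.of (Z u) = (Matrix.of (Z u))ᵀ * Matrix.of (X' u) * Matrix.of (Z u))
    (hd : (kkt (Matrix.of (X 0)) (Matrix.of (Q 0))).det ≠ 0) :
    secondVar (kkt (Matrix.of (X 0)) (Matrix.of (Q 0))) (kkt (Matrix.of (X₁ 0)) (Matrix.of (Q₁ 0))) (kkt X₂ Q₂)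
      = secondVar (kkt (Matrix.of (X' 0)) (Matrix.of (Q 0))) (kkt (Matrix.of (X'₁ 0)) (Matrix.of (Q₁ 0))) (kkt X'₂ Q₂) := by
  have hX'' : ∀ᶠ u in 𝓝 (0 : ℝ), HasDerivAt X (Matrix.of.symm (Matrix.of (X₁ u))) u := hX
  have hX''' : ∀ᶠ u in 𝓝 (0 : ℝ), HasDerivAt X' (Matrix.of.symm (Matrix.of (X'₁ u))) u := hX'
  have hQ' : ∀ᶠ u in 𝓝 (0 : ℝ), HasDerivAt Q (Matrix.of.symm (Matrix.of (Q₁ u))) u := hQ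
  -- pointwise equality of the two bordered determinants near 0
  have hdet : ∀ᶠ u in 𝓝 (0 : ℝ), (kkt (Matrix.of (X u)) (Matrix.of (Q u))).det = (kkt (Matrix.of (X' u)) (Matrix.of (Q u))).det := by
    filter_upwards [hQZ, hZZ, hQQ, hcomp] with u huQZ huZZ huQQ hucomp
    have h1 := det_kkt_mul_det_gram (Matrix.of (X u)) (Matrix.of (Q u)) (Matrix.of (Z u)) huQZ huQQ
    have h2 := det_kkt_mul_det_gram (Matrix.of (X' u)) (Matrix.of (Q u)) (Matrix.of (Z u)) huQZ huQQ
    rw [hucomp, ← h2] at h1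
    exact mul_right_cancel₀ huZZ h1
  -- the bordered curves and their jets
  have hBd : ∀ᶠ u in 𝓝 (0 : ℝ), HasDerivAt (fun u => Matrix.of.symm (kkt (Matrix.of (X u)) (Matrix.of (Q u))))
      ((fun u => Matrix.of.symm (kkt (Matrix.of (X₁ u)) (Matrix.of (Q₁ u)))) u) u := by
    filter_upwards [hX'', hQ'] with u huX huQ
    exact hasDerivAt_kkt huX huQ
  have hB₁d : HasDerivAt (fun u => Matrix.of.symm (kkt (Matrix.of (X₁ u)) (Matrix.of (Q₁ u)))) (Matrix.of.symm (kkt X₂ Q₂)) 0 :=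
    hasDerivAt_kkt hX₁ hQ₁
  have hB'd : ∀ᶠ u in 𝓝 (0 : ℝ), HasDerivAt (fun u => Matrix.of.symm (kkt (Matrix.of (X' u)) (Matrix.of (Q u))))
      ((fun u => Matrix.of.symm (kkt (Matrix.of (X'₁ u)) (Matrix.of (Q₁ u)))) u) u := by
    filter_upwards [hX''', hQ'] with u huX huQ
    exact hasDerivAt_kkt huX huQ
  have hB'₁d : HasDerivAt (fun u => Matrix.of.symm (kkt (Matrix.of (X'₁ u)) (Matrix.of (Q₁ u)))) (Matrix.of.symm (kkt X'₂ Q₂)) 0 :=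
    hasDerivAt_kkt hX'₁ hQ₁
  have hd₀ : (Matrix.of (Matrix.of.symm (kkt (Matrix.of (X 0)) (Matrix.of (Q 0))))).det ≠ 0 := by
    rw [Equiv.apply_symm_apply]; exact hd
  have hd' : (Matrix.of (Matrix.of.symm (kkt (Matrix.of (X' 0)) (Matrix.of (Q 0))))).det ≠ 0 := by
    rw [Equiv.apply_symm_apply, ← hdet.self_of_nhds]; exact hd
  have heq : ∀ᶠ u in 𝓝 (0 : ℝ), Real.log |(Matrix.of (Matrix.of.symm (kkt (Matrix.of (X u)) (Matrix.of (Q u))))).det|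
      = Real.log |(Matrix.of (Matrix.of.symm (kkt (Matrix.of (X' u)) (Matrix.of (Q u))))).det| + 0 := by
    filter_upwards [hdet] with u hu
    rw [Equiv.apply_symm_apply, Equiv.apply_symm_apply, hu, add_zero]
  have h := secondVar_eq_of_logAbsDet_eq hBd hB₁d hd₀ hB'd hB'₁d hd' heq
  simp only [Equiv.apply_symm_apply] at h
  exact h

/-! ## §2 Schur: the bordered determinant of a square -/

/-- [folklore] `det M ≠ 0`, `det(Q (MM)⁻¹ Qᵀ) ≠ 0` ⟹ `log|det kkt (MM) Q| = 2·log|det M| + log|det (Q (MM)⁻¹ Qᵀ)|` (tree `Composition.det_kkt'`: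
`det kkt X Q = (−1)^{|κ|}·det X·det(Q X⁻¹ Qᵀ)` for invertible `X`). -/
theorem logAbsDet_kkt_mul_self (M : Matrix (σ ⊕ κ) (σ ⊕ κ) ℝ) (Q : Matrix κ (σ ⊕ κ) ℝ) (hM : M.det ≠ 0)
    (hS : (Q * (M * M)⁻¹ * Qᵀ).det ≠ 0) :
    Real.log |(kkt (M * M) Q).det| = 2 * Real.log |M.det| + Real.log |(Q * (M * M)⁻¹ * Qᵀ).det| := by
  have hMM : IsUnit (M * M).det := by rw [det_mul]; exact (isUnit_iff_ne_zero.2 hM).mul (isUnit_iff_ne_zero.2 hM)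
  have h : (kkt (M * M) Q).det = (-1) ^ Fintype.card κ * ((M * M).det * (Q * (M * M)⁻¹ * Qᵀ).det) := det_kkt' (M * M) Q hMM
  rw [h, abs_mul, abs_pow, abs_neg, abs_one, one_pow, one_mul, det_mul, abs_mul, abs_mul,
    Real.log_mul (mul_ne_zero (abs_ne_zero.2 hM) (abs_ne_zero.2 hM)) (abs_ne_zero.2 hS),
    Real.log_mul (abs_ne_zero.2 hM) (abs_ne_zero.2 hM)]
  ring

/-- [folklore] The absolute determinant identity behind §3: `|det kkt (MM) Q| = |det M|² · |det (Q (MM)⁻¹ Qᵀ)|` for `det M ≠ 0`. -/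
theorem absDet_kkt_mul_self (M : Matrix (σ ⊕ κ) (σ ⊕ κ) ℝ) (Q : Matrix κ (σ ⊕ κ) ℝ) (hM : M.det ≠ 0) :
    |(kkt (M * M) Q).det| = |M.det| ^ 2 * |(Q * (M * M)⁻¹ * Qᵀ).det| := by
  have hMM : IsUnit (M * M).det := by rw [det_mul]; exact (isUnit_iff_ne_zero.2 hM).mul (isUnit_iff_ne_zero.2 hM)
  have h : (kkt (M * M) Q).det = (-1) ^ Fintype.card κ * ((M * M).det * (Q * (M * M)⁻¹ * Qᵀ).det) := det_kkt' (M * M) Q hMM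
  rw [h, abs_mul, abs_pow, abs_neg, abs_one, one_pow, one_mul, det_mul, abs_mul, abs_mul, sq]

/-! ## §3 The bordered functional of a square: scalar tower twice plus the coarse Gram -/

/-- [folklore] **UNPACKING THE BORDERED GHOST** (K-R1-SPEC §2 (v1.1) loop weights as a model theorem).  `C²` curves `X`, `Q` (the bordered
system `kkt X Q`), `M` (the scalar tower) and `S` (the coarse Gram), with `X = M·M` and `S = Q X⁻¹ Qᵀ` near `0`, `det M(0) ≠ 0`, `det S(0) ≠ 0`;
the jets of the four curves are arbitrary `C²` data (they are related by the product rule, but only their existence is used).  Then at `0`: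
`secondVar (kkt X Q) = 2·secondVar M + secondVar S`. -/
theorem secondVar_kkt_mul_self
    {X X₁ M M₁ : ℝ → (σ ⊕ κ) → (σ ⊕ κ) → ℝ} {X₂ M₂ : Matrix (σ ⊕ κ) (σ ⊕ κ) ℝ}
    {Q Q₁ : ℝ → κ → (σ ⊕ κ) → ℝ} {Q₂ : Matrix κ (σ ⊕ κ) ℝ} {S S₁ : ℝ → κ → κ → ℝ} {S₂ : Matrix κ κ ℝ}
    (hX : ∀ᶠ u in 𝓝 (0 : ℝ), HasDerivAt X (X₁ u) u) (hX₁ : HasDerivAt X₁ (Matrix.of.symm X₂) 0)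
    (hQ : ∀ᶠ u in 𝓝 (0 : ℝ), HasDerivAt Q (Q₁ u) u) (hQ₁ : HasDerivAt Q₁ (Matrix.of.symm Q₂) 0)
    (hM : ∀ᶠ u in 𝓝 (0 : ℝ), HasDerivAt M (M₁ u) u) (hM₁ : HasDerivAt M₁ (Matrix.of.symm M₂) 0)
    (hS : ∀ᶠ u in 𝓝 (0 : ℝ), HasDerivAt S (S₁ u) u) (hS₁ : HasDerivAt S₁ (Matrix.of.symm S₂) 0)
    (hXM : ∀ᶠ u in 𝓝 (0 : ℝ), Matrix.of (X u) = Matrix.of (M u) * Matrix.of (M u))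
    (hSQ : ∀ᶠ u in 𝓝 (0 : ℝ), Matrix.of (S u) = Matrix.of (Q u) * (Matrix.of (X u))⁻¹ * (Matrix.of (Q u))ᵀ)
    (hdM : (Matrix.of (M 0)).det ≠ 0) (hdS : (Matrix.of (S 0)).det ≠ 0) :
    secondVar (kkt (Matrix.of (X 0)) (Matrix.of (Q 0))) (kkt (Matrix.of (X₁ 0)) (Matrix.of (Q₁ 0))) (kkt X₂ Q₂)
      = 2 * secondVar (Matrix.of (M 0)) (Matrix.of (M₁ 0)) M₂ + secondVar (Matrix.of (S 0)) (Matrix.of (S₁ 0)) S₂ := by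
  have hX' : ∀ᶠ u in 𝓝 (0 : ℝ), HasDerivAt X (Matrix.of.symm (Matrix.of (X₁ u))) u := hX
  have hQ' : ∀ᶠ u in 𝓝 (0 : ℝ), HasDerivAt Q (Matrix.of.symm (Matrix.of (Q₁ u))) u := hQ
  -- the bordered curve and its jets
  have hBd : ∀ᶠ u in 𝓝 (0 : ℝ), HasDerivAt (fun u => Matrix.of.symm (kkt (Matrix.of (X u)) (Matrix.of (Q u))))
      ((fun u => Matrix.of.symm (kkt (Matrix.of (X₁ u)) (Matrix.of (Q₁ u)))) u) u := by
    filter_upwards [hX', hQ'] with u huX huQ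
    exact hasDerivAt_kkt huX huQ
  have hB₁d : HasDerivAt (fun u => Matrix.of.symm (kkt (Matrix.of (X₁ u)) (Matrix.of (Q₁ u)))) (Matrix.of.symm (kkt X₂ Q₂)) 0 :=
    hasDerivAt_kkt hX₁ hQ₁
  -- nondegeneracy near 0 and the logarithmic identity
  have hMne : ∀ᶠ u in 𝓝 (0 : ℝ), (Matrix.of (M u)).det ≠ 0 := eventually_det_ne_zero hM.self_of_nhds.hasFDerivAt hdM
  have hSne : ∀ᶠ u in 𝓝 (0 : ℝ), (Matrix.of (S u)).det ≠ 0 := eventually_det_ne_zero hS.self_of_nhds.hasFDerivAt hdS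
  have hlog : ∀ᶠ u in 𝓝 (0 : ℝ),
      1 * Real.log |(Matrix.of (Matrix.of.symm (kkt (Matrix.of (X u)) (Matrix.of (Q u))))).det|
      + (-2) * Real.log |(Matrix.of (M u)).det| + (-1) * Real.log |(Matrix.of (S u)).det| + 0 * Real.log |(Matrix.of (S u)).det| = 0 := by
    filter_upwards [hXM, hSQ, hMne, hSne] with u huX huS huM huSd
    have hS' : (Matrix.of (Q u) * (Matrix.of (M u) * Matrix.of (M u))⁻¹ * (Matrix.of (Q u))ᵀ).det ≠ 0 := by
      rw [← huX, ← huS]; exact huSd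
    have h := logAbsDet_kkt_mul_self (Matrix.of (M u)) (Matrix.of (Q u)) huM hS'
    rw [← huX, ← huS] at h
    show 1 * Real.log |(kkt (Matrix.of (X u)) (Matrix.of (Q u))).det| + (-2) * Real.log |(Matrix.of (M u)).det|
      + (-1) * Real.log |(Matrix.of (S u)).det| + 0 * Real.log |(Matrix.of (S u)).det| = 0
    rw [h]; ring
  -- nondegeneracy of the bordered determinant at 0
  have hdB : (Matrix.of (Matrix.of.symm (kkt (Matrix.of (X 0)) (Matrix.of (Q 0))))).det ≠ 0 := by
    show (kkt (Matrix.of (X 0)) (Matrix.of (Q 0))).det ≠ 0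
    have h := absDet_kkt_mul_self (Matrix.of (M 0)) (Matrix.of (Q 0)) hdM
    rw [← hXM.self_of_nhds, ← hSQ.self_of_nhds] at h
    intro h0
    rw [h0, abs_zero] at h
    have : (0 : ℝ) < |(Matrix.of (M 0)).det| ^ 2 * |(Matrix.of (S 0)).det| := mul_pos (pow_pos (abs_pos.2 hdM) 2) (abs_pos.2 hdS)
    linarith
  -- differentiate twice (part 1)
  have h := secondVar_comb_eq_zero (a := 1) (b := -2) (c := -1) (d := 0) (k := 0)
    hBd hB₁d hdB hM hM₁ hdM hS hS₁ hdS hS hS₁ hdS hlog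
  have h' : 1 * secondVar (kkt (Matrix.of (X 0)) (Matrix.of (Q 0))) (kkt (Matrix.of (X₁ 0)) (Matrix.of (Q₁ 0))) (kkt X₂ Q₂)
      + (-2) * secondVar (Matrix.of (M 0)) (Matrix.of (M₁ 0)) M₂ + (-1) * secondVar (Matrix.of (S 0)) (Matrix.of (S₁ 0)) S₂
      + 0 * secondVar (Matrix.of (S 0)) (Matrix.of (S₁ 0)) S₂ = 0 := h
  linarith

/-! ## §4 Polarisation (algebraic): from curves to the bilinear `(μ0; νz)` reading of `hessKer` -/

omit [DecidableEq κ] [Fintype κ] in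
/-- [folklore] **POLARISATION OF THE ONE-LOOP FUNCTIONAL.**  `secondVar` is quadratic in the first jet and linear in the second; for the jets
of a two-parameter family along the directions `b`, `b′`, `b + b′` (first jets `A₁`, `A₁′`, `A₁ + A₁′`; second jets `A₂`, `A₂′`, `A₂ + 2·A₂″ + A₂′`
with `A₂″` the mixed one):
`secondVar A₀ (A₁ + A₁′) (A₂ + 2·A₂″ + A₂′) − secondVar A₀ A₁ A₂ − secondVar A₀ A₁′ A₂′ = 2·(tr(A₀⁻¹A₂″) − tr(A₀⁻¹A₁A₀⁻¹A₁′))` —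
twice the MIXED functional, i.e. `4 ×` the typed `hessKer … μ ν z = ½·tadpole − ½·bubble`.  So every curve identity of parts 2–4, applied to the
three directions, yields the identity of the mixed functionals (the kernel-level consumers instantiate it with their bond-pair jet tables). -/
theorem secondVar_polarise {ι : Type*} [Fintype ι] [DecidableEq ι] (A₀ A₁ A₁' A₂ A₂' A₂'' : Matrix ι ι ℝ) :
    secondVar A₀ (A₁ + A₁') (A₂ + 2 • A₂'' + A₂') - secondVar A₀ A₁ A₂ - secondVar A₀ A₁' A₂'
      = 2 * ((A₀⁻¹ * A₂'').trace - (A₀⁻¹ * A₁ * (A₀⁻¹ * A₁')).trace) := by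
  have hc : (A₀⁻¹ * A₁' * (A₀⁻¹ * A₁)).trace = (A₀⁻¹ * A₁ * (A₀⁻¹ * A₁')).trace := Matrix.trace_mul_comm _ _
  simp only [secondVar, Matrix.mul_add, Matrix.add_mul, Matrix.trace_add, Matrix.mul_smul, Matrix.trace_smul, hc]
  ring

/-! ## §5 Only the `(ν ⊕ μ)` blocks of the bordered inverse enter (the typed `KInv` packing) -/

section Blocks

variable {ν μ ρ : Type*} [Fintype ν] [Fintype μ] [Fintype ρ] [DecidableEq ν] [DecidableEq μ] [DecidableEq ρ]

omit [Fintype ρ] in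
/-- [folklore] **THE JETS LIVE ON THE `(ν ⊕ μ)` BLOCKS**: with `ι := Equiv.sumAssoc ∘ inl : ν ⊕ μ ↪ ν ⊕ (μ ⊕ ρ)` and `E` its inclusion matrix,
`kkt K₁ [Q₁; 0] = E · (kkt K₁ Q₁) · Eᵀ`. -/
theorem kkt_fromRows_zero_eq_conj (K₁ : Matrix ν ν ℝ) (Q₁ : Matrix μ ν ℝ) :
    kkt K₁ (fromRows Q₁ (0 : Matrix ρ ν ℝ)) =
      (Matrix.of fun (i : ν ⊕ (μ ⊕ ρ)) (j : ν ⊕ μ) => if i = (Equiv.sumAssoc ν μ ρ) (Sum.inl j) then (1 : ℝ) else 0)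
        * kkt K₁ Q₁ *
      (Matrix.of fun (i : ν ⊕ (μ ⊕ ρ)) (j : ν ⊕ μ) => if i = (Equiv.sumAssoc ν μ ρ) (Sum.inl j) then (1 : ℝ) else 0)ᵀ := by
  ext a b
  simp only [kkt, Matrix.mul_apply, Matrix.transpose_apply, Matrix.of_apply, Fintype.sum_sum_type, Equiv.sumAssoc_apply_inl_inl,
    Equiv.sumAssoc_apply_inl_inr]
  rcases a with i | m | r <;> rcases b with j | m' | r' <;>
    simp [Matrix.fromBlocks_apply₁₁, Matrix.fromBlocks_apply₁₂, Matrix.fromBlocks_apply₂₁, Matrix.fromBlocks_apply₂₂,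
      Matrix.fromRows_apply_inl, Matrix.fromRows_apply_inr, Finset.sum_ite_eq]

/-- [folklore] **ONLY THE `(ν ⊕ μ)` COMPRESSION OF THE BORDERED INVERSE ENTERS THE ONE-LOOP FUNCTIONAL**: for ANY `X` on `ν ⊕ (μ ⊕ ρ)`
(on the road: `X = (kkt K [Q;τ])⁻¹`, whose `(ν ⊕ μ)` compression `EᵀXE` is the typed packing `KInv = [[Γ, wHᵀ],[wH, wΦ]]` of
`OneStepResolventKernel` — field and multiplier blocks, no gauge block) and jets supported on the `(ν ⊕ μ)` blocks,
`tr(X·J₂) − tr(X·J₁·X·J₁) = tr(B·kkt K₂ Q₂) − tr(B·kkt K₁ Q₁·B·kkt K₁ Q₁)` with `B := EᵀXE`. -/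
theorem oneLoop_eq_compressed (X : Matrix (ν ⊕ (μ ⊕ ρ)) (ν ⊕ (μ ⊕ ρ)) ℝ) (K₁ K₂ : Matrix ν ν ℝ) (Q₁ Q₂ : Matrix μ ν ℝ) :
    (X * kkt K₂ (fromRows Q₂ (0 : Matrix ρ ν ℝ))).trace
      - (X * kkt K₁ (fromRows Q₁ (0 : Matrix ρ ν ℝ)) * (X * kkt K₁ (fromRows Q₁ (0 : Matrix ρ ν ℝ)))).trace
    = ((Matrix.of fun (i : ν ⊕ (μ ⊕ ρ)) (j : ν ⊕ μ) => if i = (Equiv.sumAssoc ν μ ρ) (Sum.inl j) then (1 : ℝ) else 0)ᵀ * X *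
          (Matrix.of fun (i : ν ⊕ (μ ⊕ ρ)) (j : ν ⊕ μ) => if i = (Equiv.sumAssoc ν μ ρ) (Sum.inl j) then (1 : ℝ) else 0) * kkt K₂ Q₂).trace
      - ((Matrix.of fun (i : ν ⊕ (μ ⊕ ρ)) (j : ν ⊕ μ) => if i = (Equiv.sumAssoc ν μ ρ) (Sum.inl j) then (1 : ℝ) else 0)ᵀ * X *
          (Matrix.of fun (i : ν ⊕ (μ ⊕ ρ)) (j : ν ⊕ μ) => if i = (Equiv.sumAssoc ν μ ρ) (Sum.inl j) then (1 : ℝ) else 0) * kkt K₁ Q₁ *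
         ((Matrix.of fun (i : ν ⊕ (μ ⊕ ρ)) (j : ν ⊕ μ) => if i = (Equiv.sumAssoc ν μ ρ) (Sum.inl j) then (1 : ℝ) else 0)ᵀ * X *
          (Matrix.of fun (i : ν ⊕ (μ ⊕ ρ)) (j : ν ⊕ μ) => if i = (Equiv.sumAssoc ν μ ρ) (Sum.inl j) then (1 : ℝ) else 0) * kkt K₁ Q₁)).trace := by
  set E : Matrix (ν ⊕ (μ ⊕ ρ)) (ν ⊕ μ) ℝ :=
    Matrix.of fun (i : ν ⊕ (μ ⊕ ρ)) (j : ν ⊕ μ) => if i = (Equiv.sumAssoc ν μ ρ) (Sum.inl j) then (1 : ℝ) else 0 with hE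
  rw [kkt_fromRows_zero_eq_conj K₂ Q₂, kkt_fromRows_zero_eq_conj K₁ Q₁, ← hE]
  have h1 : (X * (E * kkt K₂ Q₂ * Eᵀ)).trace = (Eᵀ * X * E * kkt K₂ Q₂).trace := by
    rw [show X * (E * kkt K₂ Q₂ * Eᵀ) = (X * E * kkt K₂ Q₂) * Eᵀ by simp only [Matrix.mul_assoc], Matrix.trace_mul_comm]
    simp only [Matrix.mul_assoc]
  have h2 : (X * (E * kkt K₁ Q₁ * Eᵀ) * (X * (E * kkt K₁ Q₁ * Eᵀ))).trace
      = (Eᵀ * X * E * kkt K₁ Q₁ * (Eᵀ * X * E * kkt K₁ Q₁)).trace := by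
    rw [show X * (E * kkt K₁ Q₁ * Eᵀ) * (X * (E * kkt K₁ Q₁ * Eᵀ)) = (X * E * kkt K₁ Q₁ * Eᵀ * X * E * kkt K₁ Q₁) * Eᵀ by
      simp only [Matrix.mul_assoc], Matrix.trace_mul_comm]
    simp only [Matrix.mul_assoc]
  rw [h1, h2]

end Blocks

/-! ## §6 The fixed-weight transfer (no ghosts): (L1) alone -/

section FixedWeight

variable {ν μ ρ : Type*} [Fintype ν] [Fintype μ] [Fintype ρ] [DecidableEq ν] [DecidableEq μ] [DecidableEq ρ]

open Summit.QuantumFields.BalabanUV.Beta.D1BFx.SliceTransferModel (secondVar_sliceTransfer)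

/-- [folklore] **THE FIXED-WEIGHT TRANSFER** (part 2 with the background-INDEPENDENT weight `P := τ`: then `F = G` and the ghosts cancel):
along a `C²` background curve with `K W = 0`, `Kᵀ W = 0`, `Q W = 0` near `0`, `det(τW) ≠ 0`, `det kkt K [Q;τ] ≠ 0` at `0`,
`secondVar (kkt K [Q;τ]) (kkt K₁ [Q₁;0]) (kkt K₂ [Q₂;0]) = secondVar (kkt (K + τᵀτ) Q) (kkt K₁ Q₁) (kkt K₂ Q₂)` — the typed (sliced) functional
equals the functional of the `Q`-bordered system with the FIXED weight `τᵀτ` added and the SAME jets (no `R`-jets, no ghost).  On the road this is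
the representation «legs `Γ_R = Ga − GaQᵀCunQGa` of K-R2 (R2-a) at the `U = 1` weight, vertices = the typed Wilson/averaging jets» — exact, but
NOT the covariant representation in which an3's three-sector table is stated (that one needs part 2 with the moving weight and its two ghosts). -/
theorem secondVar_fixedWeight
    {K K₁ : ℝ → ν → ν → ℝ} {K₂ : Matrix ν ν ℝ} {Q Q₁ : ℝ → μ → ν → ℝ} {Q₂ : Matrix μ ν ℝ}
    {W W₁ : ℝ → ν → ρ → ℝ} {W₂ : Matrix ν ρ ℝ} (τ : Matrix ρ ν ℝ)
    (hK : ∀ᶠ u in 𝓝 (0 : ℝ), HasDerivAt K (K₁ u) u) (hK₁ : HasDerivAt K₁ (Matrix.of.symm K₂) 0)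
    (hQ : ∀ᶠ u in 𝓝 (0 : ℝ), HasDerivAt Q (Q₁ u) u) (hQ₁ : HasDerivAt Q₁ (Matrix.of.symm Q₂) 0)
    (hW : ∀ᶠ u in 𝓝 (0 : ℝ), HasDerivAt W (W₁ u) u) (hW₁ : HasDerivAt W₁ (Matrix.of.symm W₂) 0)
    (hKW : ∀ᶠ u in 𝓝 (0 : ℝ), Matrix.of (K u) * Matrix.of (W u) = 0)
    (hKtW : ∀ᶠ u in 𝓝 (0 : ℝ), (Matrix.of (K u))ᵀ * Matrix.of (W u) = 0)
    (hQW : ∀ᶠ u in 𝓝 (0 : ℝ), Matrix.of (Q u) * Matrix.of (W u) = 0)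
    (hτW : (τ * Matrix.of (W 0)).det ≠ 0) (hM : (kkt (Matrix.of (K 0)) (fromRows (Matrix.of (Q 0)) τ)).det ≠ 0) :
    secondVar (kkt (Matrix.of (K 0)) (fromRows (Matrix.of (Q 0)) τ))
        (kkt (Matrix.of (K₁ 0)) (fromRows (Matrix.of (Q₁ 0)) (0 : Matrix ρ ν ℝ))) (kkt K₂ (fromRows Q₂ (0 : Matrix ρ ν ℝ)))
      = secondVar (kkt (Matrix.of (K 0) + τᵀ * τ) (Matrix.of (Q 0))) (kkt (Matrix.of (K₁ 0)) (Matrix.of (Q₁ 0))) (kkt K₂ Q₂) := by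
  -- part 2 with the constant slice curve `P := τ` (so `P₁ = 0`, `P₂ = 0`)
  have hP : ∀ᶠ u in 𝓝 (0 : ℝ), HasDerivAt (fun _ : ℝ => Matrix.of.symm τ) ((fun _ : ℝ => Matrix.of.symm (0 : Matrix ρ ν ℝ)) u) u :=
    Filter.Eventually.of_forall fun u => hasDerivAt_const u _
  have hP₁ : HasDerivAt (fun _ : ℝ => Matrix.of.symm (0 : Matrix ρ ν ℝ)) (Matrix.of.symm (0 : Matrix ρ ν ℝ)) 0 := hasDerivAt_const _ _
  have hPW : (Matrix.of (Matrix.of.symm τ) * Matrix.of (W 0)).det ≠ 0 := by rw [Equiv.apply_symm_apply]; exact hτW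
  have h := secondVar_sliceTransfer τ hK hK₁ hQ hQ₁ hP hP₁ hW hW₁ hKW hKtW hQW hτW hPW hM
  simp only [Equiv.apply_symm_apply, Matrix.transpose_zero, Matrix.zero_mul, Matrix.mul_zero, add_zero, zero_add] at h
  linarith

end FixedWeight

end Summit.QuantumFields.BalabanUV.Beta.D1BFx.SliceTransferGhost
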